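import Literature.AlgebraicGeometry.Motives.FrobeniusEtale
import Literature.AlgebraicGeometry.Motives.EtalePullbackOfIso
import Literature.AlgebraicGeometry.Motives.EllAdicEtalePullback
import Literature.AlgebraicGeometry.Motives.ZetaFunction
import HarnessLib

/-!
# The Frobenius acts trivially on étale cohomology; Deligne's dictionary `F^* = φ⁻¹` (Weil I (1.15.1))

Assembling `FrobeniusEtale.lean` (the absolute Frobenius acts as the identity on the small étale
site, Milne VI Lemma 13.2), `EtalePullbackOfIso.lean` (such endomorphisms pull back as the identity
on `Hⁿ_et`), `EtaleGaloisAction.lean` / `EllAdicEtalePullback.lean` (the Galois action `ρ` on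
`Hⁿ((X_{k̄})_et, M)` and on `lim_m Hⁿ((X_{k̄})_ét, ℤ/ℓᵐ)`) and
`FrobeniusMorphism.lean` / `ZetaFunction.lean` (the `q`-Frobenius `F_{X/k} = frobeniusOver X` of a
scheme over `k = 𝔽_q` and the arithmetic/geometric Frobenius `arithFrob k`, `geomFrob k = φ⁻¹`):

* `etaleCohomologyMap_absoluteFrobenius`, `etaleCohomologyMap_powEndo_prime_pow` — **`F_Y^* = id`
  on `Hⁱ(Y_et, M)`** for the absolute Frobenius of any scheme of characteristic `p`, and for its
  powers `s ↦ s^(pʳ)` (SGA 5 XV §2; Milne VI §13);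
* `geometricFibreFrobenius X` — the `q`-Frobenius `F_{X̄}` of `X_{k̄} = X ×_k Spec k̄`, and **Milne's
  decomposition** `geometricFibreFrobenius_eq_comp : F_{X̄} = (F_{X/k} × 1) ≫ (1 × Spec φ)` (VI §13,
  p. 300: "`F_{X̄/k} = F_{X/k} ⊗ F_{k̄/k} = (1 ⊗ F_{k̄/k}) ∘ (F_{X/k} ⊗ 1)`"), so
  `etaleCohomologyMap_geometricFibreFrobenius : F_{X̄}^* = id`;
* **Deligne (1.15.1)**: `etaleCohomologyMap_frobenius_comp_arithFrob : F^*(ρ(φ) x) = x` and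
  `etaleCohomologyMap_frobenius_eq_geomFrob : F^* = ρ(geomFrob k)` on `Hⁱ((X_{k̄})_et, M)`, where
  `F^*` is the pull-back along `F_{X/k} × 1 = geometricFibreHom (frobeniusOver X)` — "On vérifie que
  `F^* = φ⁻¹` (dans `End(Hⁱ_c(X, F))`). Ceci amène à définir le Frobenius géométrique
  `F ∈ Gal(F̄_q/F_q)` comme étant `φ⁻¹`. On a (1.15.1) `F^* = F`."

This is input (D) of the assembly `hasLefschetzTraceFormula_of_frobeniusOver`
(`LefschetzTraceFormula.lean`) in its étale-cohomology form.

## References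

* P. Deligne, *La conjecture de Weil. I*, Publ. Math. IHÉS 43 (1974), (1.15), (1.15.1), p. 279.
  [Deligne1974]
* J. S. Milne, *Étale cohomology* (reissue 2025), VI §13: Lemma 13.2 and the displayed
  decomposition of `F_{X̄/k}`, p. 300. [Milne2025]

## Design notes

* `geometricFibreFrobenius X` is *defined* as the underlying morphism of `frobeniusOver` of the
  `k`-scheme `X_{k̄} → X → Spec k` (`geometricFibreOver`), i.e. the `q`-power `powEndo`
  (`geometricFibreFrobenius_eq_powEndo`, `rfl`); `powEndo_congr` moves between equal exponents.
* The `ℓ`-adic version `ellAdicEtaleCohomologyPullback_frobenius_eq_geomFrob` is componentwise.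
  What is NOT here: anything about `⊗ ℚ_ℓ`, and the trace/fixed-point side of the formula.
-/

universe u

open CategoryTheory CategoryTheory.Limits AlgebraicGeometry Opposite

namespace Literature.AlgebraicGeometry.Motives

/-! ### The Frobenius acts trivially on étale cohomology -/

section Trivial

variable (p : ℕ) [Fact p.Prime] {Y : Scheme.{u}}

/-- **The absolute Frobenius acts as the identity on `Hⁱ(Y_et, M)`** (SGA 5 XV §2; Milne VI §13,
from Lemma 13.2): `F_Y^* = id`, since base change along `F_Y` is isomorphic to the identity of the
étale site (`etaleBaseChangeAbsoluteFrobeniusIso`) and such pull-backs are the identity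
(`etaleCohomologyMap_eq_self_of_iso`). [cite: Milne2025, VI Lemma 13.2] -/
theorem etaleCohomologyMap_absoluteFrobenius (hY : (p : Γ(Y, ⊤)) = 0) (M : Ab.{u}) (i : ℕ)
    (x : ((constantSheaf Y.smallEtaleTopology Ab.{u}).obj M).H i) :
    etaleCohomologyMap (absoluteFrobenius Y p hY) M i x = x :=
  etaleCohomologyMap_eq_self_of_iso _ (etaleBaseChangeAbsoluteFrobeniusIso p hY) M i x

omit [Fact p.Prime] in
/-- `powEndo` only depends on the exponent (proof-irrelevance in the additivity witness).
[folklore] -/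
theorem powEndo_congr {m n : ℕ} (e : m = n) (hm : m ≠ 0) (hn : n ≠ 0)
    (hm' : ∀ (U : Y.Opens) (a b : Γ(Y, U)), (a + b) ^ m = a ^ m + b ^ m)
    (hn' : ∀ (U : Y.Opens) (a b : Γ(Y, U)), (a + b) ^ n = a ^ n + b ^ n) :
    powEndo Y m hm hm' = powEndo Y n hn hn' := by
  subst e
  rfl

/-- In characteristic `p`, `s ↦ s^(pʳ)` is additive on all rings of sections. [folklore] -/
theorem add_pow_prime_pow_sections (hY : (p : Γ(Y, ⊤)) = 0) (r : ℕ) (U : Y.Opens)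
    (a b : Γ(Y, U)) :
    (a + b) ^ p ^ r = a ^ p ^ r + b ^ p ^ r :=
  add_pow_prime_pow_of_natCast_eq_zero p (natCast_sections_eq_zero Y p hY U) r a b

set_option backward.isDefEq.respectTransparency false in
/-- `etaleCohomologyMap_absoluteFrobenius` for `powEndo Y p` with an arbitrary additivity witness
(the absolute Frobenius up to proof irrelevance). [cite: Milne2025, VI Lemma 13.2] -/
theorem etaleCohomologyMap_powEndo_prime (hY : (p : Γ(Y, ⊤)) = 0) (M : Ab.{u}) (i : ℕ) (hp : p ≠ 0)
    (hadd : ∀ (U : Y.Opens) (a b : Γ(Y, U)), (a + b) ^ p = a ^ p + b ^ p)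
    (x : ((constantSheaf Y.smallEtaleTopology Ab.{u}).obj M).H i) :
    etaleCohomologyMap (powEndo Y p hp hadd) M i x = x :=
  etaleCohomologyMap_eq_self_of_iso _ (etaleBaseChangeAbsoluteFrobeniusIso p hY) M i x

/-- **The `pʳ⁺¹`-power Frobenius acts as the identity on `Hⁱ(Y_et, M)`**: it is the `(r+1)`-fold
iterate of the absolute Frobenius (`powEndo_comp_powEndo`). [cite: Milne2025, VI Lemma 13.2] -/
theorem etaleCohomologyMap_powEndo_prime_pow (hY : (p : Γ(Y, ⊤)) = 0) (M : Ab.{u}) (i : ℕ) (r : ℕ)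
    (hn : p ^ (r + 1) ≠ 0)
    (hadd : ∀ (U : Y.Opens) (a b : Γ(Y, U)), (a + b) ^ p ^ (r + 1) = a ^ p ^ (r + 1) + b ^ p ^ (r + 1))
    (x : ((constantSheaf Y.smallEtaleTopology Ab.{u}).obj M).H i) :
    etaleCohomologyMap (powEndo Y (p ^ (r + 1)) hn hadd) M i x = x := by
  induction r generalizing x with
  | zero =>
    rw [powEndo_congr (Y := Y) (show p ^ (0 + 1) = p by rw [zero_add, pow_one]) hn
      (Fact.out : p.Prime).ne_zero hadd (add_pow_prime_pow_sections p hY 1 · · · |> fun h => by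
        simpa only [pow_one] using h)]
    exact etaleCohomologyMap_powEndo_prime p hY M i _ _ x
  | succ r ih =>
    rw [← powEndo_congr (Y := Y) (pow_succ p (r + 1)).symm
      (mul_ne_zero (pow_ne_zero _ (Fact.out : p.Prime).ne_zero) (Fact.out : p.Prime).ne_zero) hn
      (fun U a b => by simpa only [← pow_succ] using hadd U a b) hadd,
      ← powEndo_comp_powEndo Y p (Fact.out : p.Prime).ne_zero
        (add_pow_prime_pow_sections p hY 1 · · · |> fun h => by simpa only [pow_one] using h)
        (p ^ (r + 1)) (pow_ne_zero _ (Fact.out : p.Prime).ne_zero)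
        (add_pow_prime_pow_sections p hY (r + 1)),
      etaleCohomologyMap_comp, etaleCohomologyMap_powEndo_prime p hY M i]
    exact ih (pow_ne_zero _ (Fact.out : p.Prime).ne_zero) _ x

end Trivial

/-! ### Over a finite field: `F_{X̄} = (F_{X/k} × 1) ≫ (1 × Spec φ)` and `F^* = ρ(φ)⁻¹` -/

section FiniteField

variable {k : Type u} [Field k] [Finite k] (X : SchemeOver k)

/-- The geometric fibre `X_{k̄}` as a `k`-scheme (through the first projection to `X`). [folklore] -/
noncomputable abbrev geometricFibreOver : SchemeOver k :=
  Over.mk (pullback.fst X.hom (Spec.map (CommRingCat.ofHom (algebraMap k (AlgebraicClosure k)))) ≫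
    X.hom)

/-- **The `q`-Frobenius of the geometric fibre** `F_{X̄} : X_{k̄} → X_{k̄}`, `q = #k`: the identity on
points and `s ↦ s^q` on functions (the absolute `q`-power Frobenius of the `k`-scheme `X_{k̄}`,
Milne VI §13 `F_{X̄/k}`). [cite: Milne2025, VI §13 (p. 300)] -/
noncomputable def geometricFibreFrobenius : geometricFibre k X ⟶ geometricFibre k X :=
  (frobeniusOver (geometricFibreOver X)).left

/-- `F_{X̄}` is the `q`-power endomorphism of `X_{k̄}`. [folklore] -/
theorem geometricFibreFrobenius_eq_powEndo :
    geometricFibreFrobenius X = powEndo (geometricFibre k X) (Nat.card k) card_ne_zero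
      (add_pow_card_sections (geometricFibreOver X)) :=
  rfl

/-- The arithmetic Frobenius `φ ∈ Gal(k̄/k)` is `x ↦ x^q` as a ring endomorphism of `k̄`.
[folklore] -/
theorem toRingHom_arithFrob :
    (arithFrob k : AlgebraicClosure k ≃ₐ[k] AlgebraicClosure k).toRingHom =
      powRingHom (AlgebraicClosure k) (Nat.card k) card_ne_zero
        (add_pow_card_algebra (AlgebraicClosure k)) := by
  ext x
  rw [powRingHom_apply, ← arithFrob_smul x]
  rfl

/-- **Milne's decomposition `F_{X̄/k} = (1 ⊗ F_{k̄/k}) ∘ (F_{X/k} ⊗ 1)`** (VI §13, p. 300): on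
`X_{k̄} = X ×_k Spec k̄` the `q`-Frobenius is the base change `F_{X/k} × 1` of the `k`-linear
Frobenius of `X` followed by `1 × Spec(φ)`, `φ = (x ↦ x^q)` the arithmetic Frobenius of `k̄`
(both composites have the same two projections: `F_X` on the first factor by naturality of the
Frobenius, `Spec(x ↦ x^q)` on the second). [cite: Milne2025, VI §13 (p. 300)] -/
theorem geometricFibreFrobenius_eq_comp :
    geometricFibreFrobenius X =
      geometricFibreHom (frobeniusOver X) ≫ geometricFibreMap X (arithFrob k) := by
  apply pullback.hom_ext
  · rw [Category.assoc, geometricFibreMap_fst, geometricFibreHom_fst]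
    have h := congrArg CommaMorphism.left
      (frobeniusOver_comp (Over.homMk (pullback.fst X.hom _) rfl : geometricFibreOver X ⟶ X))
    simp only [Over.comp_left, Over.homMk_left] at h
    exact h
  · rw [Category.assoc, geometricFibreMap_snd, geometricFibreHom_snd_assoc,
      geometricFibreFrobenius_eq_powEndo, toRingHom_arithFrob,
      ← powEndo_Spec (Nat.card k) card_ne_zero (AlgebraicClosure k)
        (add_pow_card_algebra (AlgebraicClosure k))
        (add_pow_card_sections (specOver k (AlgebraicClosure k)))]
    exact powEndo_comp _ _ _ (pullback.snd _ _) _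

variable (M : Ab.{u}) (i : ℕ)

/-- **The `q`-Frobenius of `X_{k̄}` acts as the identity on `Hⁱ((X_{k̄})_et, M)`** (it is a power of the
absolute Frobenius, `#k = pⁿ`). [cite: Milne2025, VI Lemma 13.2] -/
theorem etaleCohomologyMap_geometricFibreFrobenius (x : geometricEtaleCohomology k X M i) :
    etaleCohomologyMap (geometricFibreFrobenius X) M i x = x := by
  letI := Fintype.ofFinite k
  obtain ⟨n, hp, hn⟩ := FiniteField.card k (ringChar k)
  haveI : Fact (ringChar k).Prime := ⟨hp⟩
  have hq : Nat.card k = ringChar k ^ ((n : ℕ) - 1 + 1) := by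
    rw [Nat.sub_add_cancel n.pos, Nat.card_eq_fintype_card, hn]
  have hY : (ringChar k : Γ(geometricFibre k X, ⊤)) = 0 :=
    natCast_ringChar_sections (geometricFibreOver X) ⊤
  rw [geometricFibreFrobenius_eq_powEndo,
    powEndo_congr (Y := geometricFibre k X) hq card_ne_zero
      (pow_ne_zero _ hp.ne_zero) (add_pow_card_sections (geometricFibreOver X))
      (add_pow_prime_pow_sections (ringChar k) hY _)]
  exact etaleCohomologyMap_powEndo_prime_pow (ringChar k) hY M i _ _ _ x

/-- **Deligne's dictionary (1.15.1), `F^* ∘ φ = id`**: on `Hⁱ((X_{k̄})_et, M)` the pull-back along the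
base-changed `k`-Frobenius `F = F_{X/k} × 1` composed with the Galois action of the arithmetic
Frobenius `φ` is the identity — "on vérifie que `F^* = φ⁻¹`" (Weil I, (1.15), p. 279).
[cite: Deligne1974, (1.15.1)] -/
theorem etaleCohomologyMap_frobenius_comp_arithFrob (x : geometricEtaleCohomology k X M i) :
    etaleCohomologyMap (geometricFibreHom (frobeniusOver X)) M i
        (geometricEtaleCohomologyRep X M i (arithFrob k) x) = x := by
  rw [geometricEtaleCohomologyRep_apply, ← etaleCohomologyMap_comp,
    ← geometricFibreFrobenius_eq_comp]
  exact etaleCohomologyMap_geometricFibreFrobenius X M i x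

/-- **`F^* = ρ(F_geom)` on `Hⁱ((X_{k̄})_et, M)`** (Deligne, Weil I (1.15.1): "`F^* = φ⁻¹` … Ceci amène à
définir le Frobenius géométrique `F ∈ Gal(F̄_q/F_q)` comme étant `φ⁻¹`. On a `F^* = F`"): the
pull-back along `F_{X/k} × 1` is the action of the geometric Frobenius `geomFrob k = (arithFrob k)⁻¹`.
[cite: Deligne1974, (1.15.1)] -/
theorem etaleCohomologyMap_frobenius_eq_geomFrob (x : geometricEtaleCohomology k X M i) :
    etaleCohomologyMap (geometricFibreHom (frobeniusOver X)) M i x =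
      geometricEtaleCohomologyRep X M i (geomFrob k) x := by
  have h := etaleCohomologyMap_frobenius_comp_arithFrob X M i
    (geometricEtaleCohomologyRep X M i (geomFrob k) x)
  have e : geometricEtaleCohomologyRep X M i (arithFrob k)
      (geometricEtaleCohomologyRep X M i (geomFrob k) x) = x := by
    change (geometricEtaleCohomologyRep X M i (arithFrob k) *
      geometricEtaleCohomologyRep X M i (geomFrob k)) x = x
    rw [← map_mul, ← geomFrob_inv, inv_mul_cancel, map_one]
    rfl
  rw [e] at h
  exact h

/-- **`F^* = ρ(F_geom)` on `ℓ`-adic étale cohomology `lim_m Hⁱ((X_{k̄})_ét, ℤ/ℓᵐ)`** (Deligne (1.15.1),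
componentwise from `etaleCohomologyMap_frobenius_eq_geomFrob`). [cite: Deligne1974, (1.15.1)] -/
theorem ellAdicEtaleCohomologyPullback_frobenius_eq_geomFrob (ℓ : ℕ)
    (a : towerLim (etaleCohomologyZModPowMap (geometricFibre k X) ℓ i)) :
    ellAdicEtaleCohomologyPullback (geometricFibreHom (frobeniusOver X)) ℓ i a =
      geometricEllAdicEtaleCohomologyRep X ℓ i (geomFrob k) a :=
  Subtype.ext <| funext fun m =>
    etaleCohomologyMap_frobenius_eq_geomFrob X (zmodPowAb.{u} ℓ m) i (a.1 m)

end FiniteField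

end Literature.AlgebraicGeometry.Motives
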